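import Summits.NavierStokesRegularity.NavierStokesRegularity.Theorems.PerpetualPumpAveragedTypeIBlowupPreBootModes
import Summits.NavierStokesRegularity.NavierStokesRegularity.Theorems.PerpetualPumpAveragedTypeIBlowupPreBootRegime
import Summits.NavierStokesRegularity.NavierStokesRegularity.Theorems.PerpetualPumpAveragedTypeIBlowupTrailPairLoose
import Summits.NavierStokesRegularity.NavierStokesRegularity.Theorems.PerpetualPumpAveragedTypeIBlowupLevelOnePre

/-!
# Crux `PerpetualPump.AveragedTypeIBlowup` (stmt-NavierStokesRegularity-1835), line `Sketch`:
# stub `preBoot` — the quiet trail and the level-1 pair under the loose induction hypothesis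

Third file of the proof of the registered stub `stub_preBoot` (the pre-ignition bootstrap of the
window one-step theorem: a joint continuous induction in real time on 2× looser boxes, inside
which the phase lemmas return the tight boxes). Here, on a pre-ignition horizon `[t₀, S]`:

* `preBoot_trail` (registered tools sub-goal) — every trail mode `n₀ ≤ k ≤ n − 2` stays in its
  tight box, by `stub_trailPairLoose` in the mode's own clock from its entry time recorded in the
  hand-off invariant, the loose boxes of its neighbours supplying the inflow / residual-carrier
  hypotheses;
* `preBoot_levelOne` — the level-1 pair stays tiny, by `stub_levelOnePre` in the front clock,
  fed by the pre-ignition front bond and the loose rung above.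

Every mode is read in slow time through `handoff_sysPkg` (`…HandoffSlow`) and the clock algebra of
`…PreBootModes`.

## References

T. Tao, *Finite time blowup for an averaged three-dimensional Navier–Stokes equation*, J. Amer.
Math. Soc. 29 (2016), 601–674, §5–6 (the cascade / circuit heuristics); the estimates are
folklore ODE bookkeeping.
-/

noncomputable section

-- the summit namespace `…NavierStokesRegularity.NavierStokesRegularity…` is the tree convention
set_option linter.dupNamespace false

open Set MeasureTheory Filter Topology

namespace Summit.NavierStokesRegularity.NavierStokesRegularity.Theorems.PerpetualPumpAveragedTypeIBlowup
/-- **The quiet trail under the loose induction hypothesis.** On `[t₀, S]`, if the trail modes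
`n₀ ≤ k ≤ n − 2` and the previous carrier `b_{n−1}` satisfy the LOOSE bounds (`|w_k| ≤ 1/50`,
`b_k ∈ [−1/2, 9/10]`), then every trail mode satisfies its TIGHT box (`b_k ∈ [−9/20, 7/20]`,
`|w_k| ≤ 1/100`, majorants `≤ 10(b_hi+4)² + 1`): `stub_trailPairLoose` in the mode's own clock
from its entry time `te` recorded in the hand-off invariant (`ω = 1/100`, `μ = 10(b_hi+4)²`,
inflow `w_{k−1}/q^{3/2}`, residual carrier `b_{k+1}/q`). Registered tools sub-goal `preBoot_trail` of the
stub `preBoot`. [folklore] -/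
theorem preBoot_trail :
    ∀ (ε₀ D εb θ η F bhi q T t₀ S : ℝ) (n₀ n : ℤ) (bv wv M0 M1 db dw G0 G1 : ℤ → ℝ → ℝ)
      (R : ℤ → ℝ),
      (q = Real.sqrt (1 + ε₀)) →
      (∀ k : ℤ, R k = D * (1 + ε₀) ^ (2 * k)) →
      (∀ (k : ℤ) (t : ℝ), G0 k t = (wv (k - 1) t) ^ 2 / q ^ 3 - (wv k t) ^ 2 - εb * bv k t * wv k t) →
      (∀ (k : ℤ) (t : ℝ), G1 k t = wv k t * (bv k t - bv (k + 1) t / q) + εb * (bv k t) ^ 2) →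
      (0 < ε₀) →
      (ε₀ ≤ 1 / 20) →
      (0 < D) →
      (1 / 2 ≤ θ) →
      (θ ≤ 1) →
      (0 ≤ η) →
      (0 < εb) →
      (εb ≤ 1 / 10 ^ 6) →
      (0 ≤ F) →
      (1 ≤ bhi + 4) →
      (η * (10 ^ 9 * (bhi + 4) ^ 4 * (F + 1)) ≤ 1) →
      (∀ k : ℤ, k < n₀ → ∀ t ∈ Icc 0 T, bv k t = 0 ∧ wv k t = 0 ∧ M0 k t = 0 ∧ M1 k t = 0) →
      (∀ k : ℤ, ContinuousOn (bv k) (Icc 0 T) ∧ ContinuousOn (wv k) (Icc 0 T) ∧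
        ContinuousOn (M0 k) (Icc 0 T) ∧ ContinuousOn (M1 k) (Icc 0 T)) →
      (∀ k : ℤ, ContinuousOn (db k) (Icc 0 T) ∧ ContinuousOn (dw k) (Icc 0 T) ∧
        ∀ t ∈ Ioo 0 T, HasDerivAt (bv k) (db k t) t ∧
        |db k t - R k * (-(bv k t) + G0 k t)| ≤ η * R k * M0 k t ∧
        HasDerivAt (wv k) (dw k t) t ∧ |dw k t - R k * (-(wv k t) + G1 k t)| ≤ η * R k * M1 k t) →
      (∀ k : ℤ, ∀ t ∈ Icc 0 T, |bv k t| ≤ M0 k t ∧ |wv k t| ≤ M1 k t ∧ 0 ≤ M0 k t ∧ 0 ≤ M1 k t) →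
      (∀ k : ℤ, ∀ t₁ ∈ Icc 0 T, ∀ t₂ ∈ Icc t₁ T,
        M0 k t₂ ≤ M0 k t₁ * Real.exp (-(θ * R k * (t₂ - t₁))) +
        R k * ∫ u in t₁..t₂, Real.exp (-(θ * R k * (t₂ - u))) * |G0 k u| ∧
        M1 k t₂ ≤ M1 k t₁ * Real.exp (-(θ * R k * (t₂ - t₁))) +
        R k * ∫ u in t₁..t₂, Real.exp (-(θ * R k * (t₂ - u))) * |G1 k u|) →
      (0 < T) →
      (t₀ ≤ S) →
      (S ≤ T) →
      (∀ k : ℤ, n₀ ≤ k → k ≤ n - 2 → ∃ te ∈ Icc 0 t₀,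
        (-(2 / 5) ≤ bv k te ∧ bv k te ≤ 3 / 10 ∧ |wv k te| ≤ 1 / 200 ∧
        M0 k te ≤ 10 * (bhi + 4) ^ 2 ∧ M1 k te ≤ 10 * (bhi + 4) ^ 2) ∧
        ∀ s ∈ Icc te t₀, -(9 / 20) ≤ bv k s ∧ bv k s ≤ 7 / 20 ∧ |wv k s| ≤ 1 / 100 ∧
        M0 k s ≤ 10 * (bhi + 4) ^ 2 + 1 ∧ M1 k s ≤ 10 * (bhi + 4) ^ 2 + 1 ∧
        |wv (k - 1) s| ≤ 1 / 100 ∧ -(1 / 2) ≤ bv (k + 1) s ∧ bv (k + 1) s ≤ 9 / 10) →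
      (∀ u ∈ Icc t₀ S, ∀ k : ℤ, n₀ ≤ k → k ≤ n - 2 →
        |wv k u| ≤ 1 / 50 ∧ -(1 / 2) ≤ bv k u ∧ bv k u ≤ 9 / 10) →
      (n₀ ≤ n - 1 → ∀ u ∈ Icc t₀ S, -(1 / 2) ≤ bv (n - 1) u ∧ bv (n - 1) u ≤ 9 / 10) →
      ∀ k : ℤ, n₀ ≤ k → k ≤ n - 2 → ∀ u ∈ Icc t₀ S,
      -(9 / 20) ≤ bv k u ∧ bv k u ≤ 7 / 20 ∧ |wv k u| ≤ 1 / 100 ∧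
      M0 k u ≤ 10 * (bhi + 4) ^ 2 + 1 ∧ M1 k u ≤ 10 * (bhi + 4) ^ 2 + 1 := by
  intro ε₀ D εb θ η F bhi q T t₀ S n₀ n bv wv M0 M1 db dw G0 G1 R hq hR hG0 hG1 hε₀ hε₀' hD hθ hθ1
    hη hεb hεb6 hF0 hbhi hηreg hzero hcont hC1 hmaj hrest hT hS hST hInvTr hLTr hLP k hk1 hk2
  obtain ⟨te, hte, ⟨hb0l, hb0u, hw0, hm00, hm10⟩, hbox⟩ := hInvTr k hk1 hk2
  obtain ⟨hRpos, hRkk, -, -, -, -, -, -, -, hq0, hq2⟩ := preBoot_rates hε₀ hε₀' hD hR hq n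
  have hq1 : 1 ≤ q := by nlinarith
  have hRk := hRpos k
  have hθ0 : 0 < θ := by linarith
  obtain ⟨hη9, -, hη2, -⟩ := preBoot_eta hη hF0 hbhi hηreg
  -- the neighbours in real time on `[te, S]`
  have hteS : te ≤ S := hte.2.trans hS
  have hwl : ∀ t ∈ Icc te S, |wv (k - 1) t| ≤ 1 / 50 := by
    intro t ht
    rcases le_total t t₀ with h | h
    · have := (hbox t ⟨ht.1, h⟩).2.2.2.2.2.1
      linarith
    · by_cases hk : n₀ ≤ k - 1
      · exact (hLTr t ⟨h, ht.2⟩ (k - 1) hk (by omega)).1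
      · have h0 := (hzero (k - 1) (by omega) t ⟨hte.1.trans ht.1, ht.2.trans hST⟩).2.1
        rw [h0, abs_zero]
        norm_num
  have hbr : ∀ t ∈ Icc te S, -(1 / 2) ≤ bv (k + 1) t ∧ bv (k + 1) t ≤ 9 / 10 := by
    intro t ht
    rcases le_total t t₀ with h | h
    · exact (hbox t ⟨ht.1, h⟩).2.2.2.2.2.2
    · by_cases hk : k + 1 ≤ n - 2
      · exact (hLTr t ⟨h, ht.2⟩ (k + 1) (by omega) hk).2
      · have hk' : k + 1 = n - 1 := by omega
        rw [hk']
        exact hLP (by omega) t ⟨h, ht.2⟩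
  -- the slow time of the mode `k` from `te`
  set S' := R k * (S - te) with hS'
  have hS'0 : 0 ≤ S' := mul_nonneg hRk.le (by linarith)
  have hST' : te + S' / R k ≤ T := by
    rw [hS', mul_div_cancel_left₀ _ hRk.ne']
    linarith
  obtain ⟨⟨hbc, hm0c, -, he0c, hdb, he0, hm0D⟩, ⟨hwc, hm1c, -, he1c, hdw, he1, hm1D⟩⟩ :=
    handoff_sysPkg (k := k) hG0 hG1 hcont hC1 hmaj hrest hRk hT hte.1 hS'0 hST'
  obtain ⟨⟨-, -⟩, ⟨hwlc, -⟩⟩ :=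
    handoff_sysPkg (k := k - 1) hG0 hG1 hcont hC1 hmaj hrest hRk hT hte.1 hS'0 hST'
  obtain ⟨⟨hbrc, -⟩, -⟩ :=
    handoff_sysPkg (k := k + 1) hG0 hG1 hcont hC1 hmaj hrest hRk hT hte.1 hS'0 hST'
  have hpush := (preBoot_push (tb := te) (s₁ := S) hRk).1
  -- the forcings in bracket form
  have hG0k : ∀ t, G0 k t =
      -(wv k t) ^ 2 + (wv (k - 1) t / (q * Real.sqrt q)) ^ 2 - εb * bv k t * wv k t := by
    intro t
    rw [hG0, (preBoot_divsq hq1 _).1]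
    ring
  -- hypotheses of the trail lemma
  have h1 : ContinuousOn (fun τ => wv (k - 1) (te + τ / R k) / (q * Real.sqrt q)) (Icc 0 S') :=
    hwlc.div_const _
  have h2 : ContinuousOn (fun τ => bv (k + 1) (te + τ / R k) / q) (Icc 0 S') := hbrc.div_const _
  have h3 : ∀ τ ∈ Ioo 0 S', HasDerivAt (fun s => bv k (te + s / R k))
      (-(bv k (te + τ / R k)) - (wv k (te + τ / R k)) ^ 2 +
        (wv (k - 1) (te + τ / R k) / (q * Real.sqrt q)) ^ 2 -
        εb * bv k (te + τ / R k) * wv k (te + τ / R k) +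
        (db k (te + τ / R k) - R k * (-(bv k (te + τ / R k)) + G0 k (te + τ / R k))) / R k) τ := by
    intro τ hτ
    refine (hdb τ hτ).congr_deriv ?_
    rw [hRkk, hG0k]
    ring
  have h4 : ∀ τ ∈ Ioo 0 S', HasDerivAt (fun s => wv k (te + s / R k))
      (wv k (te + τ / R k) * (bv k (te + τ / R k) - bv (k + 1) (te + τ / R k) / q - 1) +
        εb * (bv k (te + τ / R k)) ^ 2 +
        (dw k (te + τ / R k) - R k * (-(wv k (te + τ / R k)) + G1 k (te + τ / R k))) / R k) τ := by
    intro τ hτ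
    refine (hdw τ hτ).congr_deriv ?_
    rw [hRkk, hG1]
    ring
  have h5 : ∀ τ ∈ Icc 0 S',
      |(db k (te + τ / R k) - R k * (-(bv k (te + τ / R k)) + G0 k (te + τ / R k))) / R k| ≤
        η * M0 k (te + τ / R k) := by
    intro τ hτ
    have := he0 τ hτ
    rwa [hRkk, mul_one] at this
  have h6 : ∀ τ ∈ Icc 0 S',
      |(dw k (te + τ / R k) - R k * (-(wv k (te + τ / R k)) + G1 k (te + τ / R k))) / R k| ≤
        η * M1 k (te + τ / R k) := by
    intro τ hτ
    have := he1 τ hτ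
    rwa [hRkk, mul_one] at this
  have h7 : ∀ τ ∈ Icc 0 S', 0 ≤ M0 k (te + τ / R k) ∧
      M0 k (te + τ / R k) ≤ M0 k (te + 0 / R k) * Real.exp (-(θ * τ)) +
        ∫ u in (0 : ℝ)..τ, Real.exp (-(θ * (τ - u))) *
          |-(wv k (te + u / R k)) ^ 2 + (wv (k - 1) (te + u / R k) / (q * Real.sqrt q)) ^ 2 -
            εb * bv k (te + u / R k) * wv k (te + u / R k)| := by
    intro τ hτ
    have := hm0D τ hτ
    simp only [hRkk, mul_one, one_mul, hG0k] at this
    exact this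
  have h8 : ∀ τ ∈ Icc 0 S', 0 ≤ M1 k (te + τ / R k) ∧
      M1 k (te + τ / R k) ≤ M1 k (te + 0 / R k) * Real.exp (-(θ * τ)) +
        ∫ u in (0 : ℝ)..τ, Real.exp (-(θ * (τ - u))) *
          |wv k (te + u / R k) * (bv k (te + u / R k) - bv (k + 1) (te + u / R k) / q) +
            εb * (bv k (te + u / R k)) ^ 2| := by
    intro τ hτ
    have := hm1D τ hτ
    simp only [hRkk, mul_one, one_mul, hG1] at this
    exact this
  have h9 : ∀ τ ∈ Icc 0 S', |wv (k - 1) (te + τ / R k) / (q * Real.sqrt q)| ≤ 2 * (1 / 100) := by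
    intro τ hτ
    have := (preBoot_divsq hq1 (wv (k - 1) (te + τ / R k))).2
    have h' := hwl _ (hpush τ hτ)
    linarith
  have h10 : ∀ τ ∈ Icc 0 S', -(1 / 2) ≤ bv (k + 1) (te + τ / R k) / q ∧
      bv (k + 1) (te + τ / R k) / q ≤ 9 / 10 := by
    intro τ hτ
    have h' := hbr _ (hpush τ hτ)
    exact (preBoot_div_q hq1).1 _ h'.1 h'.2
  have hte0 : te + 0 / R k = te := by simp
  have key := stub_trailPairLoose (fun τ => bv k (te + τ / R k)) (fun τ => wv k (te + τ / R k))
    (fun τ => M0 k (te + τ / R k)) (fun τ => M1 k (te + τ / R k))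
    (fun τ => wv (k - 1) (te + τ / R k) / (q * Real.sqrt q))
    (fun τ => bv (k + 1) (te + τ / R k) / q)
    (fun τ => (db k (te + τ / R k) - R k * (-(bv k (te + τ / R k)) + G0 k (te + τ / R k))) / R k)
    (fun τ => (dw k (te + τ / R k) - R k * (-(wv k (te + τ / R k)) + G1 k (te + τ / R k))) / R k)
    θ η εb (1 / 100) (10 * (bhi + 4) ^ 2) S' hθ hθ1 hη hεb (by linarith) le_rfl (by positivity)
    (by nlinarith) (by nlinarith) (by linarith) hS'0 hbc hwc hm0c hm1c h1 h2 he0c he1c h3 h4 h5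
    h6 h7 h8 h9 h10 (by rw [hte0]; exact hb0l) (by rw [hte0]; exact hb0u)
    (by rw [hte0]; linarith) (by rw [hte0]; exact hm00) (by rw [hte0]; exact hm10)
  -- back to real time
  have hexp : ∀ τ : ℝ, 0 ≤ τ → 10 * (bhi + 4) ^ 2 * Real.exp (-(θ * τ)) ≤ 10 * (bhi + 4) ^ 2 :=
    fun τ hτ => mul_le_of_le_one_right (by positivity)
      (Real.exp_le_one_iff.2 (by nlinarith))
  have hc1 : 6 * (1 / 100) ^ 2 / θ ≤ 1 := by
    rw [div_le_one hθ0]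
    linarith
  have hc2 : 3 * (1 / 100) / θ ≤ 1 := by
    rw [div_le_one hθ0]
    linarith
  intro u hu
  refine (preBoot_pull (P := fun s => -(9 / 20) ≤ bv k s ∧ bv k s ≤ 7 / 20 ∧ |wv k s| ≤ 1 / 100 ∧
    M0 k s ≤ 10 * (bhi + 4) ^ 2 + 1 ∧ M1 k s ≤ 10 * (bhi + 4) ^ 2 + 1) hRk).1 (fun σ hσ => ?_) u
    ⟨hte.2.trans hu.1, hu.2⟩
  obtain ⟨k1, k2, k3, -, k5, k6⟩ := key σ hσ
  exact ⟨k1, k2, k3, by linarith [hexp σ hσ.1], by linarith [hexp σ hσ.1]⟩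


/-- **The level-1 pair under the loose induction hypothesis.** On `[t₀, S]` (`R_n(S − t₀) ≤ 3`):
from the pre-ignition front (`w_n² ≤ b_n/100`, `b_n ≤ B e^{-σ} + 5/2`, `R_n ∫ w_n² ≤ 1/100`) and
the loose rung above (`|b_{n+2}| ≤ 1/2`), the next carrier/bond and their majorants stay tiny:
`stub_levelOnePre` in the front clock (rate `q⁴`, `Bx = B + 3`, `Iw = 1/100`). [folklore] -/
theorem preBoot_levelOne {ε₀ D εb θ η F bhi q T t₀ S B : ℝ} {n : ℤ}
    {bv wv M0 M1 db dw G0 G1 : ℤ → ℝ → ℝ} {R : ℤ → ℝ}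
    (hq : q = Real.sqrt (1 + ε₀)) (hR : ∀ k : ℤ, R k = D * (1 + ε₀) ^ (2 * k))
    (hG0 : ∀ (k : ℤ) (t : ℝ), G0 k t = (wv (k - 1) t) ^ 2 / q ^ 3 - (wv k t) ^ 2 - εb * bv k t * wv k t)
    (hG1 : ∀ (k : ℤ) (t : ℝ), G1 k t = wv k t * (bv k t - bv (k + 1) t / q) + εb * (bv k t) ^ 2)
    (hε₀ : 0 < ε₀) (hε₀' : ε₀ ≤ 1 / 20) (hD : 0 < D) (hθ : 1 / 2 ≤ θ) (hθ1 : θ ≤ 1) (hη : 0 ≤ η)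
    (hεb : 0 < εb) (hεb6 : εb ≤ 1 / 10 ^ 6) (hF0 : 0 ≤ F) (hbhi : 1 ≤ bhi + 4)
    (hηreg : η * (10 ^ 9 * (bhi + 4) ^ 4 * (F + 1)) ≤ 1) (hB1 : 1 ≤ B) (hBhi : B ≤ bhi)
    (hcont : ∀ k : ℤ, ContinuousOn (bv k) (Icc 0 T) ∧ ContinuousOn (wv k) (Icc 0 T) ∧
      ContinuousOn (M0 k) (Icc 0 T) ∧ ContinuousOn (M1 k) (Icc 0 T))
    (hC1 : ∀ k : ℤ, ContinuousOn (db k) (Icc 0 T) ∧ ContinuousOn (dw k) (Icc 0 T) ∧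
      ∀ t ∈ Ioo 0 T, HasDerivAt (bv k) (db k t) t ∧
        |db k t - R k * (-(bv k t) + G0 k t)| ≤ η * R k * M0 k t ∧
        HasDerivAt (wv k) (dw k t) t ∧ |dw k t - R k * (-(wv k t) + G1 k t)| ≤ η * R k * M1 k t)
    (hmaj : ∀ k : ℤ, ∀ t ∈ Icc 0 T, |bv k t| ≤ M0 k t ∧ |wv k t| ≤ M1 k t ∧ 0 ≤ M0 k t ∧ 0 ≤ M1 k t)
    (hrest : ∀ k : ℤ, ∀ t₁ ∈ Icc 0 T, ∀ t₂ ∈ Icc t₁ T,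
      M0 k t₂ ≤ M0 k t₁ * Real.exp (-(θ * R k * (t₂ - t₁))) +
          R k * ∫ u in t₁..t₂, Real.exp (-(θ * R k * (t₂ - u))) * |G0 k u| ∧
        M1 k t₂ ≤ M1 k t₁ * Real.exp (-(θ * R k * (t₂ - t₁))) +
          R k * ∫ u in t₁..t₂, Real.exp (-(θ * R k * (t₂ - u))) * |G1 k u|)
    (hT : 0 < T) (ht₀ : 0 ≤ t₀) (hS : t₀ ≤ S) (hST : S ≤ T) (hS3 : R n * (S - t₀) ≤ 3)
    (hInv1 : |bv (n + 1) t₀| ≤ εb ∧ |wv (n + 1) t₀| ≤ εb ∧ M0 (n + 1) t₀ ≤ εb ∧ M1 (n + 1) t₀ ≤ εb)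
    (hnoig : ∀ u ∈ Icc t₀ S, (wv n u) ^ 2 ≤ bv n u / 100)
    (hFr : ∀ u ∈ Icc t₀ S, bv n u ≤ B * Real.exp (-(R n * (u - t₀))) + 5 / 2)
    (hIw : R n * ∫ t in t₀..S, (wv n t) ^ 2 ≤ 1 / 100)
    (hL2 : ∀ u ∈ Icc t₀ S, |bv (n + 2) u| ≤ 1 / 2) :
    ∀ u ∈ Icc t₀ S, |bv (n + 1) u| ≤ εb + q / 100 + 1 / 10 ^ 3 ∧ |wv (n + 1) u| ≤ 11 / 10 * εb ∧
      M0 (n + 1) u ≤ εb + (B + 3) / 40 ∧ M1 (n + 1) u ≤ 4 * εb := by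
  obtain ⟨hRpos, -, -, hκ, -, -, -, -, -, hq0, hq2⟩ := preBoot_rates hε₀ hε₀' hD hR hq n
  have hq1 : 1 ≤ q := by nlinarith
  have hq21 : q ≤ 21 / 20 := by nlinarith
  have hRn := hRpos n
  obtain ⟨-, hη1, -⟩ := preBoot_eta hη hF0 hbhi hηreg
  -- slow time of the front
  set S' := R n * (S - t₀) with hS'
  have hS'0 : 0 ≤ S' := mul_nonneg hRn.le (by linarith)
  have hST' : t₀ + S' / R n ≤ T := by
    rw [hS', mul_div_cancel_left₀ _ hRn.ne']
    linarith
  obtain ⟨⟨hxc, hmxc, -, hexc, hdx, hex, hmxD⟩, ⟨hyc, hmyc, -, heyc, hdy, hey, hmyD⟩⟩ :=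
    handoff_sysPkg (k := n + 1) hG0 hG1 hcont hC1 hmaj hrest hRn hT ht₀ hS'0 hST'
  obtain ⟨-, ⟨hwc, -⟩⟩ := handoff_sysPkg (k := n) hG0 hG1 hcont hC1 hmaj hrest hRn hT ht₀ hS'0 hST'
  obtain ⟨⟨hx2c, -⟩, -⟩ :=
    handoff_sysPkg (k := n + 2) hG0 hG1 hcont hC1 hmaj hrest hRn hT ht₀ hS'0 hST'
  obtain ⟨hmem, hpush⟩ := preBoot_push (tb := t₀) (s₁ := S) hRn
  obtain ⟨-, htime, ht00⟩ := preBoot_time (tb := t₀) hRn.ne'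
  -- the forcings of the level-1 pair
  have hG0' : ∀ t, G0 (n + 1) t =
      (wv n t) ^ 2 / q ^ 3 - (wv (n + 1) t) ^ 2 - εb * bv (n + 1) t * wv (n + 1) t := by
    intro t
    rw [hG0, show n + 1 - 1 = n by ring]
  have hG1' : ∀ t, G1 (n + 1) t =
      wv (n + 1) t * (bv (n + 1) t - bv (n + 2) t / q) + εb * (bv (n + 1) t) ^ 2 := by
    intro t
    rw [hG1, show n + 1 + 1 = n + 2 by ring]
  -- hypotheses of `stub_levelOnePre`
  have h1 : ∀ σ ∈ Ioo 0 S', HasDerivAt (fun s => bv (n + 1) (t₀ + s / R n))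
      (q ^ 4 * (-(bv (n + 1) (t₀ + σ / R n)) + (wv n (t₀ + σ / R n)) ^ 2 / q ^ 3 -
        (wv (n + 1) (t₀ + σ / R n)) ^ 2 - εb * bv (n + 1) (t₀ + σ / R n) * wv (n + 1) (t₀ + σ / R n)) +
        (db (n + 1) (t₀ + σ / R n) -
          R (n + 1) * (-(bv (n + 1) (t₀ + σ / R n)) + G0 (n + 1) (t₀ + σ / R n))) / R n) σ := by
    intro σ hσ
    refine (hdx σ hσ).congr_deriv ?_
    rw [hκ, hG0']
    ring
  have h2 : ∀ σ ∈ Ioo 0 S', HasDerivAt (fun s => wv (n + 1) (t₀ + s / R n))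
      (q ^ 4 * (wv (n + 1) (t₀ + σ / R n) *
          (bv (n + 1) (t₀ + σ / R n) - bv (n + 2) (t₀ + σ / R n) / q - 1) +
        εb * (bv (n + 1) (t₀ + σ / R n)) ^ 2) +
        (dw (n + 1) (t₀ + σ / R n) -
          R (n + 1) * (-(wv (n + 1) (t₀ + σ / R n)) + G1 (n + 1) (t₀ + σ / R n))) / R n) σ := by
    intro σ hσ
    refine (hdy σ hσ).congr_deriv ?_
    rw [hκ, hG1']
    ring
  have h3 : ∀ σ ∈ Icc 0 S', |(db (n + 1) (t₀ + σ / R n) -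
      R (n + 1) * (-(bv (n + 1) (t₀ + σ / R n)) + G0 (n + 1) (t₀ + σ / R n))) / R n| ≤
        η * q ^ 4 * M0 (n + 1) (t₀ + σ / R n) := by
    intro σ hσ
    have := hex σ hσ
    rwa [hκ] at this
  have h4 : ∀ σ ∈ Icc 0 S', |(dw (n + 1) (t₀ + σ / R n) -
      R (n + 1) * (-(wv (n + 1) (t₀ + σ / R n)) + G1 (n + 1) (t₀ + σ / R n))) / R n| ≤
        η * q ^ 4 * M1 (n + 1) (t₀ + σ / R n) := by
    intro σ hσ
    have := hey σ hσ
    rwa [hκ] at this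
  have h5 : ∀ σ ∈ Icc 0 S', 0 ≤ M0 (n + 1) (t₀ + σ / R n) ∧
      M0 (n + 1) (t₀ + σ / R n) ≤ M0 (n + 1) (t₀ + 0 / R n) * Real.exp (-(θ * q ^ 4 * σ)) +
        q ^ 4 * ∫ u in (0 : ℝ)..σ, Real.exp (-(θ * q ^ 4 * (σ - u))) *
          |(wv n (t₀ + u / R n)) ^ 2 / q ^ 3 - (wv (n + 1) (t₀ + u / R n)) ^ 2 -
            εb * bv (n + 1) (t₀ + u / R n) * wv (n + 1) (t₀ + u / R n)| := by
    intro σ hσ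
    have := hmxD σ hσ
    simp only [hκ, hG0'] at this
    exact this
  have h6 : ∀ σ ∈ Icc 0 S', 0 ≤ M1 (n + 1) (t₀ + σ / R n) ∧
      M1 (n + 1) (t₀ + σ / R n) ≤ M1 (n + 1) (t₀ + 0 / R n) * Real.exp (-(θ * q ^ 4 * σ)) +
        q ^ 4 * ∫ u in (0 : ℝ)..σ, Real.exp (-(θ * q ^ 4 * (σ - u))) *
          |wv (n + 1) (t₀ + u / R n) * (bv (n + 1) (t₀ + u / R n) - bv (n + 2) (t₀ + u / R n) / q) +
            εb * (bv (n + 1) (t₀ + u / R n)) ^ 2| := by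
    intro σ hσ
    have := hmyD σ hσ
    simp only [hκ, hG1'] at this
    exact this
  have h7 : ∀ σ ∈ Icc 0 S', (wv n (t₀ + σ / R n)) ^ 2 ≤ (B + 3) / 100 := by
    intro σ hσ
    have hm := hmem σ hσ
    have ha := hnoig _ hm
    have hb := hFr _ hm
    have he : B * Real.exp (-(R n * (t₀ + σ / R n - t₀))) ≤ B :=
      mul_le_of_le_one_right (by linarith) (Real.exp_le_one_iff.2 (by
        rw [htime]; linarith [hσ.1]))
    linarith
  have h8 : ∀ σ ∈ Icc 0 S', ∫ u in (0 : ℝ)..σ, (wv n (t₀ + u / R n)) ^ 2 ≤ 1 / 100 := by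
    intro σ hσ
    have hm := hmem σ hσ
    have e1 : ∫ u in (0 : ℝ)..σ, (wv n (t₀ + u / R n)) ^ 2 =
        ∫ t in (t₀ + 0 / R n)..(t₀ + σ / R n), R n * (wv n t) ^ 2 := by
      rw [integral_rescale (fun t => (wv n t) ^ 2) hRn.ne' 0 σ]
    have e2 : ∫ t in (t₀ + 0 / R n)..(t₀ + σ / R n), R n * (wv n t) ^ 2 ≤
        ∫ t in t₀..S, R n * (wv n t) ^ 2 := by
      rw [ht00]
      refine intervalIntegral.integral_mono_interval le_rfl hm.1 hm.2
        (Filter.Eventually.of_forall fun t => ?_) ?_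
      · simp only [Pi.zero_apply]
        positivity
      · exact (continuousOn_const.mul (((hcont n).2.1.mono (Icc_subset_Icc ht₀ hST)).pow 2)
          ).intervalIntegrable_of_Icc hS
    have e3 : ∫ t in t₀..S, R n * (wv n t) ^ 2 = R n * ∫ t in t₀..S, (wv n t) ^ 2 :=
      intervalIntegral.integral_const_mul _ _
    linarith
  have h9 : ∀ σ ∈ Icc 0 S', |bv (n + 2) (t₀ + σ / R n)| ≤ 1 / 2 := fun σ hσ => hL2 _ (hmem σ hσ)
  obtain ⟨hi1, hi2, hi3, hi4⟩ := hInv1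
  have key := stub_levelOnePre (fun σ => bv (n + 1) (t₀ + σ / R n))
    (fun σ => wv (n + 1) (t₀ + σ / R n)) (fun σ => wv n (t₀ + σ / R n))
    (fun σ => bv (n + 2) (t₀ + σ / R n)) (fun σ => M0 (n + 1) (t₀ + σ / R n))
    (fun σ => M1 (n + 1) (t₀ + σ / R n))
    (fun σ => (db (n + 1) (t₀ + σ / R n) -
      R (n + 1) * (-(bv (n + 1) (t₀ + σ / R n)) + G0 (n + 1) (t₀ + σ / R n))) / R n)
    (fun σ => (dw (n + 1) (t₀ + σ / R n) -
      R (n + 1) * (-(wv (n + 1) (t₀ + σ / R n)) + G1 (n + 1) (t₀ + σ / R n))) / R n)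
    q θ η εb (B + 3) (1 / 100) S' hq1 hq21 hθ hθ1 hη hεb hεb6 (by linarith) (by nlinarith)
    (by norm_num) (by norm_num) hS'0 (by linarith) hxc hyc hwc hx2c hmxc hmyc hexc heyc h1 h2 h3
    h4 h5 h6 h7 h8 h9 (by rw [ht00]; exact hi1) (by rw [ht00]; exact hi2) (by rw [ht00]; exact hi3)
    (by rw [ht00]; exact hi4)
  refine (preBoot_pull (P := fun s => |bv (n + 1) s| ≤ εb + q / 100 + 1 / 10 ^ 3 ∧
    |wv (n + 1) s| ≤ 11 / 10 * εb ∧ M0 (n + 1) s ≤ εb + (B + 3) / 40 ∧ M1 (n + 1) s ≤ 4 * εb)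
    hRn).1 fun σ hσ => ?_
  obtain ⟨k1, k2, k3, k4⟩ := key σ hσ
  exact ⟨by linarith, k2, k3, k4⟩

end Summit.NavierStokesRegularity.NavierStokesRegularity.Theorems.PerpetualPumpAveragedTypeIBlowup

end
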